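import Summits.Parity.GeneralizedHardyLittlewood.Theorems.LeeYangFibresAbsoluteUpgradeDipDefs
import Summits.Parity.GeneralizedHardyLittlewood.Theorems.LeeYangFibresAbsoluteUpgradeRoughAnatomy
import Summits.Parity.GeneralizedHardyLittlewood.Theorems.PrimeCellsRelative.Negative.FalseWithoutBoxContainment
import Summits.Parity.GeneralizedHardyLittlewood.Theorems.AbsoluteUpgrade.Negative.FibreHyperbolicityAlongLoadBearing
import Literature.NumberTheory.Sieve.LinearEquationsInPrimesDimOne
import HarnessLib

/-!
# `AbsoluteUpgrade` (stmt-Parity-14116), line `dip-margin-rate-exchange`: box containment is load-bearing in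
# the input `CellParityLawSaving` (negative lemma)

Negative-side support (refuter cdisprove seat, gen 2).  The second open stub of the picked line is the guarded
conjectural input `stub_cellParityLawSaving : RelativeDimOne → CellParityLawSaving`
(`Theorems/LeeYangFibresAbsoluteUpgradeDipDefs`: the cell-parity law along the schedule `u = slowDegree N`
with a `(log N)^{-δ}` saving and a purely ABSOLUTE allowance `N/(log^t N (log N)^δ)`).  This file records,
sorry-free and unconditionally, that the containment `K ⊆ [-N, N]` of its UNGUARDED conclusion cannot be
dropped (variant stated inline; no proposition is defined under `Summits/`):

* `cellParityLawSaving_false_without_boxContainment` — at `t = 1`, `L = 1`, for `ψ(n) = n` (`∏_p β_p = 1`)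
  on the far box `K = [2N, 10N]` (`β_∞ = 8N`, tree `BoxContainment.archFactor_id_farBox`) every joint cell is
  EMPTY (no lattice point of `[-N, N]` lies in `K`), while the Walsh-weighted models of the two cells `j = 1`
  and `j = 2` are `8(1 + θ₀)A₁(N)` and `8(1 - θ₀)A₂(N)` with `A_m(N) = cell (slowDegree N) N m ≥ cell 4 N m ≥
  c N/log N` (tree: `roughCell_four_le`, `stub_roughAnatomy`); since `(1 + θ₀) + (1 - θ₀) = 2` WHATEVER the
  amplitude `θ₀`, one of the two deviations is `≥ 8cN/log N`, which beats the allowance `N/(log N)^{1+δ}` as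
  soon as `(log N)^δ > 1/c`.  (The bound `|θ_S| ≤ 2` is not even used: the parity amplitudes cannot rescue a
  body whose lattice content and measure disagree.)

Moral for the planner at promote time: like `PrimeCellsRelative` (`Theorems/PrimeCellsRelative/Negative/*`),
the rate clause sees `K` through `β_∞` and the cells through `K ∩ ℤ ∩ [-N, N]`; the box containment (with
convexity) is what reconciles them, and the free Walsh amplitudes do not weaken this.  This file does NOT
refute the crux or the stub (the guarded stub is irrefutable short of proving `RelativeDimOne`,
`Cruxes/AbsoluteUpgrade/Disproof.lean` §8).
[folklore]
-/

noncomputable section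

namespace Summit.Parity.GeneralizedHardyLittlewood.Theorems.AbsoluteUpgrade.Negative

open scoped BigOperators Classical
open Filter MeasureTheory Literature.NumberTheory.Sieve
open Summit.Parity.GeneralizedHardyLittlewood.Cruxes.FibreHyperbolicity.ModelTransfer (jointCell)
open Summit.Parity.GeneralizedHardyLittlewood.Cruxes.AbsoluteUpgrade.DipMarginRateExchange
  (slowDegree four_le_slowDegree)
open Summit.Parity.GeneralizedHardyLittlewood.Theorems.ModelHyperbolicity.Negative (cell)
open Summit.Parity.GeneralizedHardyLittlewood.Cruxes.AbsoluteUpgrade.NlcCellsAbsoluteClip (roughCell)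
open Summit.Parity.GeneralizedHardyLittlewood.Theorems.AbsoluteUpgrade (roughCell_four_le stub_roughAnatomy)
open Summit.Parity.GeneralizedHardyLittlewood.Theorems.PrimeCellsRelative.Negative.BoxContainment
  (archFactor_id_farBox singularProduct_id)
open Summit.Parity.GeneralizedHardyLittlewood.Theorems.AbsoluteUpgrade.Negative.FibreAlong
  (jointCell_eq_zero_of_forall_not_mem isNondegenerateSystem_id affLinSize_id)

namespace CellSaving

/-- The two cell vocabularies agree: `Negative.cell u N m = NlcCellsAbsoluteClip.roughCell N u m`. [folklore] -/
theorem cell_eq_roughCell (u N m : ℕ) : cell u N m = roughCell N u m := rfl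

/-- No lattice point of `[-N, N]` has its real point in the far box `[2N, 10N]` (`N ≥ 1`). [folklore] -/
theorem realPoint_not_mem_farBox {N : ℕ} (hN : 1 ≤ N) {n : Fin 1 → ℤ} (hn : n ∈ latticeBox 1 N) :
    realPoint n ∉ Set.Icc (fun _ : Fin 1 => (2 * N : ℝ)) (fun _ => 10 * N) := by
  rintro ⟨h1, -⟩
  have h1' : (2 * N : ℝ) ≤ (n 0 : ℝ) := h1 0
  simp only [latticeBox, Fintype.mem_piFinset, Finset.mem_Icc] at hn
  have h2 : (n 0 : ℝ) ≤ N := by exact_mod_cast (hn 0).2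
  have hN' : (1 : ℝ) ≤ N := by exact_mod_cast hN
  linarith

/-- The Walsh form at `t = 1`: `Σ_{S ⊆ {0}} θ_S ∏_{i∈S} (-1)^{j_i+1} = θ_∅ + θ_{{0}} (-1)^{j_0+1}`. [folklore] -/
theorem walsh_fin_one (θ : Finset (Fin 1) → ℝ) (j : Fin 1 → ℕ) :
    (∑ S : Finset (Fin 1), θ S * ∏ i ∈ S, (-1 : ℝ) ^ (j i + 1)) =
      θ ∅ + θ Finset.univ * (-1 : ℝ) ^ (j 0 + 1) := by
  have huniv : (Finset.univ : Finset (Finset (Fin 1))) = {∅, Finset.univ} := by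
    ext S
    simp only [Finset.mem_univ, Finset.mem_insert, Finset.mem_singleton, true_iff]
    rcases S.eq_empty_or_nonempty with h | ⟨x, hx⟩
    · exact Or.inl h
    · right
      rw [Finset.eq_univ_iff_forall]
      intro y
      rwa [Subsingleton.elim y x]
  have hne : (∅ : Finset (Fin 1)) ≠ Finset.univ := Finset.univ_nonempty.ne_empty.symm
  rw [huniv, Finset.sum_pair hne, Finset.prod_empty, mul_one, Fin.prod_univ_one]

end CellSaving

open CellSaving

/-- **The box containment `K ⊆ [-N, N]` of `CellParityLawSaving` cannot be dropped.** Without it, at `t = 1`,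
`L = 1`: `ψ(n) = n` on the far box `[2N, 10N]` has empty joint cells against the models `8(1 ± θ₀) A_{1,2}(N)`,
`A_m(N) ≥ c N/log N` (rough anatomy at `u = 4` and monotonicity in `u ≥ 4`), and `(1+θ₀) + (1-θ₀) = 2` forces a
deviation `≥ 8cN/log N > N/(log N)^{1+δ}` for `(log N)^δ > 1/c`. [folklore] -/
theorem cellParityLawSaving_false_without_boxContainment :
    ¬ (∀ (t L : ℕ), 1 ≤ t → ∃ δ : ℝ, 0 < δ ∧ ∃ N₀ : ℕ, ∀ N : ℕ, N₀ ≤ N →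
        ∀ Ψ : Fin t → AffLinForm 1, IsNondegenerateSystem Ψ → affLinSize Ψ N ≤ L →
        ∀ K : Set (Fin 1 → ℝ), Convex ℝ K →
        ∃ θ : Finset (Fin t) → ℝ, θ ∅ = 1 ∧ (∀ S, |θ S| ≤ 2) ∧
          ∀ j : Fin t → ℕ, (∀ i, 1 ≤ j i ∧ j i ≤ slowDegree N) →
            |(jointCell t N (slowDegree N) Ψ K j : ℝ) -
                (∑ S : Finset (Fin t), θ S * ∏ i ∈ S, (-1 : ℝ) ^ (j i + 1)) *
                  (archFactor Ψ K * singularProduct Ψ *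
                    ∏ i, (cell (slowDegree N) N (j i) : ℝ) / N)| ≤
              (N : ℝ) / (Real.log N ^ t * Real.log N ^ δ)) := by
  intro h
  obtain ⟨δ, hδ, N₀, hN₀⟩ := h 1 1 le_rfl
  obtain ⟨c, hc, N₁, hN₁⟩ := stub_roughAnatomy 4
  -- a scale with everything in place
  have hT3 : Tendsto (fun N : ℕ => Real.log (Real.log (Real.log (N : ℝ)))) atTop atTop :=
    Real.tendsto_log_atTop.comp (Real.tendsto_log_atTop.comp
      (Real.tendsto_log_atTop.comp tendsto_natCast_atTop_atTop))
  have hTp : Tendsto (fun N : ℕ => Real.log (N : ℝ) ^ δ) atTop atTop :=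
    (tendsto_rpow_atTop hδ).comp (Real.tendsto_log_atTop.comp tendsto_natCast_atTop_atTop)
  have hev : ∀ᶠ N : ℕ in atTop, N₀ ≤ N ∧ N₁ ≤ N ∧ 3 ≤ N ∧
      1 ≤ Real.log (Real.log (Real.log (N : ℝ))) ∧ 1 / c < Real.log (N : ℝ) ^ δ :=
    (eventually_ge_atTop N₀).and ((eventually_ge_atTop N₁).and ((eventually_ge_atTop 3).and
      ((hT3.eventually_ge_atTop 1).and (hTp.eventually_gt_atTop (1 / c)))))
  obtain ⟨N, hNN₀, hNN₁, hN3, hlll, hpow⟩ := hev.exists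
  have hN1 : 1 ≤ N := by omega
  have hNpos : (0 : ℝ) < N := by exact_mod_cast (show 0 < N by omega)
  have hlogpos : 0 < Real.log N := Real.log_pos (by exact_mod_cast (show 1 < N by omega))
  have hP : 0 < Real.log N ^ δ := Real.rpow_pos_of_pos hlogpos δ
  -- rough anatomy at `u = 4`, transported to `u = slowDegree N ≥ 4`
  obtain ⟨hlow, -, -⟩ := hN₁ N hNN₁ 4 le_rfl (by push_cast; linarith)
  have hA1 : c * N / Real.log N ≤ (cell (slowDegree N) N 1 : ℝ) := by
    refine (hlow 1 (by simp)).trans ?_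
    rw [cell_eq_roughCell]
    exact_mod_cast roughCell_four_le hN1 (four_le_slowDegree N) 1
  have hA2 : c * N / Real.log N ≤ (cell (slowDegree N) N 2 : ℝ) := by
    refine (hlow 2 (by simp)).trans ?_
    rw [cell_eq_roughCell]
    exact_mod_cast roughCell_four_le hN1 (four_le_slowDegree N) 2
  have hB : 0 < c * N / Real.log N := by positivity
  -- the law on the far box
  obtain ⟨θ, hθ0, -, hj⟩ := hN₀ N hNN₀ (fun _ => ⟨fun _ => 1, 0⟩) isNondegenerateSystem_id
    (affLinSize_id _) (Set.Icc (fun _ : Fin 1 => (2 * N : ℝ)) (fun _ => 10 * N)) (convex_Icc _ _)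
  have hU4 := four_le_slowDegree N
  have h1 := hj (fun _ => 1) (fun _ => ⟨le_rfl, by omega⟩)
  have h2 := hj (fun _ => 2) (fun _ => ⟨by norm_num, by omega⟩)
  have hz : ∀ j : Fin 1 → ℕ, (jointCell 1 N (slowDegree N) (fun _ => ⟨fun _ => 1, 0⟩)
      (Set.Icc (fun _ : Fin 1 => (2 * N : ℝ)) (fun _ => 10 * N)) j : ℝ) = 0 := fun j => by
    rw [jointCell_eq_zero_of_forall_not_mem _ (fun n hn => realPoint_not_mem_farBox hN1 hn) j]
    simp
  rw [hz, walsh_fin_one, hθ0, archFactor_id_farBox, singularProduct_id, Fin.prod_univ_one, pow_one,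
    zero_sub, abs_neg] at h1 h2
  -- the two models: `8 (1 + θ₀) A₁` and `8 (1 - θ₀) A₂`
  set x : ℝ := θ Finset.univ with hx
  set a₁ : ℝ := (cell (slowDegree N) N 1 : ℝ) with ha₁
  set a₂ : ℝ := (cell (slowDegree N) N 2 : ℝ) with ha₂
  set E : ℝ := (N : ℝ) / (Real.log N * Real.log N ^ δ) with hE
  have hE0 : 0 ≤ E := by positivity
  have hm1 : (1 + x * (-1 : ℝ) ^ (1 + 1)) * (8 * (N : ℝ) * 1 * (a₁ / N)) = (1 + x) * (8 * a₁) := by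
    field_simp
    norm_num
    ring
  have hm2 : (1 + x * (-1 : ℝ) ^ (2 + 1)) * (8 * (N : ℝ) * 1 * (a₂ / N)) = (1 - x) * (8 * a₂) := by
    field_simp
    norm_num
    ring
  rw [hm1] at h1
  rw [hm2] at h2
  have e1 : (1 + x) * (8 * a₁) ≤ E := (le_abs_self _).trans h1
  have e2 : (1 - x) * (8 * a₂) ≤ E := (le_abs_self _).trans h2
  have f1 : (1 + x) * (8 * (c * N / Real.log N)) ≤ E := by
    rcases le_or_gt 0 (1 + x) with hx0 | hx0
    · exact le_trans (by gcongr) e1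
    · have : (1 + x) * (8 * (c * N / Real.log N)) < 0 := mul_neg_of_neg_of_pos hx0 (by positivity)
      linarith
  have f2 : (1 - x) * (8 * (c * N / Real.log N)) ≤ E := by
    rcases le_or_gt 0 (1 - x) with hx0 | hx0
    · exact le_trans (by gcongr) e2
    · have : (1 - x) * (8 * (c * N / Real.log N)) < 0 := mul_neg_of_neg_of_pos hx0 (by positivity)
      linarith
  have hfinal : 8 * (c * N / Real.log N) ≤ E := by linarith
  -- `8 c (log N)^δ ≤ 1` against `c (log N)^δ > 1`
  rw [hE, show 8 * (c * (N : ℝ) / Real.log N) = 8 * c * N / Real.log N by ring,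
    div_le_div_iff₀ hlogpos (mul_pos hlogpos hP)] at hfinal
  have hcP : 1 < c * Real.log N ^ δ := by
    have := (div_lt_iff₀ hc).mp hpow
    linarith [mul_comm (Real.log (N : ℝ) ^ δ) c]
  nlinarith [mul_lt_mul_of_pos_right hcP (mul_pos hNpos hlogpos), mul_pos hNpos hlogpos]

end Summit.Parity.GeneralizedHardyLittlewood.Theorems.AbsoluteUpgrade.Negative

end
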